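import Summits.CriticalPhenomena.PercolationContinuityZ3.Theorems.PercNearOneGluingNoHeavyLowerTailFourPointAtoms
import Summits.CriticalPhenomena.PercolationContinuityZ3.Theorems.PercNearOneGluingNoHeavyLowerTailGroupSepHybridRows
import Summits.CriticalPhenomena.PercolationContinuityZ3.Theorems.PercNearOneGluingNoHeavyLowerTailFourPointFaceIdentity
import Summits.CriticalPhenomena.PercolationContinuityZ3.Theorems.PercNearOneGluingNoHeavyLowerTailFourPointL2FromL1
import Summits.CriticalPhenomena.PercolationContinuityZ3.Theorems.PercNearOneGluingNoHeavyLowerTailGroupThreePointLB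
import HarnessLib

/-!
# `NoHeavyLowerTail` (crux stmt-CriticalPhenomena-4575): **(L1) ⇒ (L2), (B1), (B2) on EVERY finite weighted graph** — the polarised row
# `PolarisedRowL1` is the single named hypothesis of the SHK3⁺ terminal-edge step

Support file (prover seat `prim-bnk-1`, bounded-n kernel lane, gen 3; `--supports stmt-CriticalPhenomena-4575`).  No definitions, no named
facts, no sorries, no `native_decide`.

SETTING (run/shared/lean/ttrl/bern4 'POLARIZATION L1/L2'; tree `…CubicThreePointBernsteinStep`, `…CubicThreePointPolarization`,
`…FourPointFaceDefs/FaceIdentity/L2FromL1` (prim-l12-p6), `…GroupSepHybridRows` (the named open rows `PolarisedRowL1`, `PolarisedRowL2`)).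
Along the apex edge `{a,y}` the Bernstein pieces of SHK3⁺ are `threeB₁ = polL₁ + F(x⁰) + (β₁+β₂)·H(D_ab,D_ac)` and
`threeB₂ = polL₂ + (β₁+β₂)·(H(D_ac,D[ay|b]) + H(D[ay|c],D_ab))` with `polL₂ = polL₁ + hybE₃g + σ·«a|bcy»·(«ab|cy»+«ac|by»)` — CELL identities
in the 15-cell law of `(a,b,c,y)`.  Every ingredient except (L1) is a theorem in the tree for ALL finite weighted graphs: `F ≥ 0` is SHK3⁺ =
3PT-LB (`ThreePointLB.sahiE3_pairSep_nonneg`, prim-lit-2/prim-cert-2), `hybE₃g ≥ 0` is the group row `E₃(D[ay|b], D[ay|c], D_bc) ≥ 0`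
(`GroupThreePointLB.sahiE3_groupPairSep_nonneg`, prim-ineq-prove-3), the `H` terms are Harris.  (L1) itself has an exact theorem-rows
certificate (prim-facecert FULL_L1_D5_KM2_regionA_THEOREMROWS / prim-l12-p6 cert_L1_thmrows_exact; kernel replay in progress, prim-l12-p2).

THIS FILE moves those identities to the MEASURE level with the four-point atom dictionary `…FourPointAtoms` and proves, for every finite
vertex type `V`, every `w : Sym2 V → [0,1]` and all `a b c y : V` (no distinctness needed):
* `polL₁_cell_eq` / `polL₂_cell_eq` / `hybE₃g_cell_eq(')` / `F_cell_eq` — the cell forms ARE the measure-level rows (`sahiE3` expressions of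
  `PolarisedRowL1/L2`, of GRP3PTLB and of SHK3⁺) at the cells of `prodBernoulli w`;
* `hybE₃g_cell_nonneg`, `F_cell_nonneg`, `harris_*_cell` — the proved rows in cells;
* `polL₁_cell_nonneg`, `polL₂_cell_nonneg`, **`threeB₁_cell_nonneg`, `threeB₂_cell_nonneg`** — from `PolarisedRowL1`: (B1), (B2) at the
  cells of every finite weighted graph;
* **`polarisedRowL2_of_polarisedRowL1 : PolarisedRowL1 → PolarisedRowL2`**.
Companion `…TerminalEdgeStepAllN`: `PolarisedRowL1 → ∀ N₀, BernsteinStepUpTo N₀ ∧ PolarisedStepUpTo N₀` (the bounded-`n` statements of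
`…TerminalEdgeStepLeFive` for every `N₀`) and the bridge `CubicFourPointL1.L1Conj ⇒ PolarisedRowL1` to prim-l12-p2's vocabulary.  So the
kernel replay of the (L1) certificate, in either vocabulary, closes (L2), (B1), (B2) for all graphs by `apply`.
-/

noncomputable section

namespace Summit.CriticalPhenomena.PercolationContinuityZ3.Theorems

open MeasureTheory Set Literature.Probability.Percolation

namespace TerminalEdgeStep

open FourPointAtoms CubicFourPoint CubicThreePointStep
open Literature.Probability.LatticeModels (prodBernoulli sahiE3 sahiE3_def prodBernoulli_harris_lower)
open Literature.Combinatorics.Sahi2008 (isLowerSet_compl_openConn)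

section Cells

variable {V : Type} [Fintype V] (w : Sym2 V → unitInterval) (a b c y : V)

/-! ### (L1) at cell level -/

set_option maxRecDepth 10000 in
set_option maxHeartbeats 1600000 in
/-- **The polarised form (L1) of a finite weighted graph is `polL₁` of its four-point cells**: for `μ = prodBernoulli w` and any
`a b c y`, `polL₁(cells) = [E₃(D_bc,D_ac,D[ay|b]) + E₃(D_bc,D[ay|c],D_ab)] − μ(a|bcy)·μ(D_bc)` (the two sides of `PolarisedRowL1`). [this work] -/
theorem polL₁_cell_eq :
    polL₁ (cell w a b c y 0) (cell w a b c y 1) (cell w a b c y 2) (cell w a b c y 3) (cell w a b c y 4) (cell w a b c y 5) (cell w a b c y 6) (cell w a b c y 7) (cell w a b c y 8) (cell w a b c y 9) (cell w a b c y 10) (cell w a b c y 11) (cell w a b c y 12) (cell w a b c y 13) (cell w a b c y 14) =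
      sahiE3 (prodBernoulli w) (openConn b c)ᶜ (openConn a c)ᶜ ((openConn b a)ᶜ ∩ (openConn b y)ᶜ) +
        sahiE3 (prodBernoulli w) (openConn b c)ᶜ ((openConn c a)ᶜ ∩ (openConn c y)ᶜ) (openConn a b)ᶜ -
      (prodBernoulli w).real ((openConn a b)ᶜ ∩ (openConn b c ∩ openConn b y)) * (prodBernoulli w).real (openConn b c)ᶜ := by
  rw [sahiE3_def, sahiE3_def, real_hyb1_ABC, real_hyb1_A, real_hyb1_B, real_hyb1_C, real_hyb1_BC, real_hyb1_AC, real_hyb1_AB,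
    real_hyb2_ABC, real_hyb2_B, real_hyb2_C, real_hyb2_BC, real_hyb2_AC, real_hyb2_AB, real_beta]
  simp only [polL₁, hybE₁, hybE₂, E3h]
  rw [sum_cell_eq_one w a b c y]
  ring

/-- **(L1) ⇒ `polL₁(cells) ≥ 0`** on every finite weighted graph. [this work] -/
theorem polL₁_cell_nonneg (hL1 : PolarisedRowL1) :
    0 ≤ polL₁ (cell w a b c y 0) (cell w a b c y 1) (cell w a b c y 2) (cell w a b c y 3) (cell w a b c y 4) (cell w a b c y 5) (cell w a b c y 6) (cell w a b c y 7) (cell w a b c y 8) (cell w a b c y 9) (cell w a b c y 10) (cell w a b c y 11) (cell w a b c y 12) (cell w a b c y 13) (cell w a b c y 14) := by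
  rw [polL₁_cell_eq]
  exact sub_nonneg.2 (hL1 V w a b c y)

/-! ### The shape-(i) group row `E₃(D_bc, D[ay|c], D[ay|b]) ≥ 0` (GRP3PTLB, a theorem) at cell level -/

set_option maxRecDepth 10000 in
set_option maxHeartbeats 1600000 in
/-- `hybE₃g(cells) = E₃(D_bc, D[ay|c], D[ay|b])` in the orientation of `PolarisedRowL2`. [this work] -/
theorem hybE₃g_cell_eq :
    hybE₃g (cell w a b c y 0) (cell w a b c y 1) (cell w a b c y 2) (cell w a b c y 3) (cell w a b c y 4) (cell w a b c y 5) (cell w a b c y 6) (cell w a b c y 7) (cell w a b c y 8) (cell w a b c y 9) (cell w a b c y 10) (cell w a b c y 11) (cell w a b c y 12) (cell w a b c y 13) (cell w a b c y 14) =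
      sahiE3 (prodBernoulli w) (openConn b c)ᶜ ((openConn c a)ᶜ ∩ (openConn c y)ᶜ) ((openConn b a)ᶜ ∩ (openConn b y)ᶜ) := by
  rw [sahiE3_def, real_hyb3_ABC, real_hyb1_A, real_hyb2_B, real_hyb1_C, real_hyb3_BC, real_hyb1_AC, real_hyb2_AB]
  simp only [hybE₃g, E3h]
  rw [sum_cell_eq_one w a b c y]
  ring

set_option maxRecDepth 10000 in
set_option maxHeartbeats 1600000 in
/-- `hybE₃g(cells)` in the orientation delivered by `GroupThreePointLB.sahiE3_groupPairSep_nonneg` with `A = {a,y}`, `B = {b}`, apex `c`: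
`E₃({a↮b} ∩ {y↮b}, {a↮c} ∩ {y↮c}, {b↮c})`. [this work] -/
theorem hybE₃g_cell_eq' :
    hybE₃g (cell w a b c y 0) (cell w a b c y 1) (cell w a b c y 2) (cell w a b c y 3) (cell w a b c y 4) (cell w a b c y 5) (cell w a b c y 6) (cell w a b c y 7) (cell w a b c y 8) (cell w a b c y 9) (cell w a b c y 10) (cell w a b c y 11) (cell w a b c y 12) (cell w a b c y 13) (cell w a b c y 14) =
      sahiE3 (prodBernoulli w) ((openConn a b)ᶜ ∩ (openConn y b)ᶜ) ((openConn a c)ᶜ ∩ (openConn y c)ᶜ) (openConn b c)ᶜ := by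
  rw [sahiE3_def, real_grp_ABC, real_grp_A, real_grp_B, real_hyb1_A, real_grp_BC, real_grp_AC, real_grp_AB]
  simp only [hybE₃g, E3h]
  rw [sum_cell_eq_one w a b c y]
  ring

/-- **`hybE₃g(cells) ≥ 0` on every finite weighted graph** — an instance of prim-ineq-prove-3's theorem `GRP3PTLB`
(`GroupThreePointLB.sahiE3_groupPairSep_nonneg`: Sahi's `E₃ ≥ 0` for the pairwise separations of the vertex sets `{a,y}`, `{b}` and the
vertex `c`). [this work] -/
theorem hybE₃g_cell_nonneg :
    0 ≤ hybE₃g (cell w a b c y 0) (cell w a b c y 1) (cell w a b c y 2) (cell w a b c y 3) (cell w a b c y 4) (cell w a b c y 5) (cell w a b c y 6) (cell w a b c y 7) (cell w a b c y 8) (cell w a b c y 9) (cell w a b c y 10) (cell w a b c y 11) (cell w a b c y 12) (cell w a b c y 13) (cell w a b c y 14) := by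
  classical
  rw [hybE₃g_cell_eq']
  have h := GroupThreePointLB.sahiE3_groupPairSep_nonneg w ({a, y} : Finset V) ({b} : Finset V) c
  simp only [Finset.set_biInter_insert, Finset.set_biInter_singleton] at h
  exact h

/-! ### (L1) ⇒ (L2) -/

set_option maxRecDepth 10000 in
set_option maxHeartbeats 1600000 in
/-- **The polarised form (L2) is `polL₂` of the cells**: `polL₂(cells) = [E₃(D_bc,D[ay|c],D[ay|b]) + E₃(D_bc,D_ac,D[ay|b]) +
E₃(D_bc,D[ay|c],D_ab)] − μ(a|bcy)·μ(G_bc)` (the two sides of `PolarisedRowL2`). [this work] -/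
theorem polL₂_cell_eq :
    polL₂ (cell w a b c y 0) (cell w a b c y 1) (cell w a b c y 2) (cell w a b c y 3) (cell w a b c y 4) (cell w a b c y 5) (cell w a b c y 6) (cell w a b c y 7) (cell w a b c y 8) (cell w a b c y 9) (cell w a b c y 10) (cell w a b c y 11) (cell w a b c y 12) (cell w a b c y 13) (cell w a b c y 14) =
      sahiE3 (prodBernoulli w) (openConn b c)ᶜ ((openConn c a)ᶜ ∩ (openConn c y)ᶜ) ((openConn b a)ᶜ ∩ (openConn b y)ᶜ) +
          sahiE3 (prodBernoulli w) (openConn b c)ᶜ (openConn a c)ᶜ ((openConn b a)ᶜ ∩ (openConn b y)ᶜ) +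
          sahiE3 (prodBernoulli w) (openConn b c)ᶜ ((openConn c a)ᶜ ∩ (openConn c y)ᶜ) (openConn a b)ᶜ -
        (prodBernoulli w).real ((openConn a b)ᶜ ∩ (openConn b c ∩ openConn b y)) *
          (prodBernoulli w).real ((openConn b c)ᶜ ∩ (openConn b a ∩ openConn c y)ᶜ ∩ (openConn b y ∩ openConn c a)ᶜ) := by
  rw [sahiE3_def, sahiE3_def, sahiE3_def, real_hyb3_ABC, real_hyb1_A, real_hyb2_B, real_hyb1_C, real_hyb3_BC, real_hyb1_AC,
    real_hyb2_AB, real_hyb1_ABC, real_hyb1_B, real_hyb1_BC, real_hyb1_AB, real_hyb2_ABC, real_hyb2_C, real_hyb2_BC, real_hyb2_AC,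
    real_beta, real_Gbc]
  simp only [polL₂, hybE₃g, hybE₁, hybE₂, E3h]
  rw [sum_cell_eq_one w a b c y]
  ring

/-- **(L1) ⇒ `polL₂(cells) ≥ 0`** (via prim-l12-p6's `polL₁_le_polL₂` and the group row). [this work] -/
theorem polL₂_cell_nonneg (hL1 : PolarisedRowL1) :
    0 ≤ polL₂ (cell w a b c y 0) (cell w a b c y 1) (cell w a b c y 2) (cell w a b c y 3) (cell w a b c y 4) (cell w a b c y 5) (cell w a b c y 6) (cell w a b c y 7) (cell w a b c y 8) (cell w a b c y 9) (cell w a b c y 10) (cell w a b c y 11) (cell w a b c y 12) (cell w a b c y 13) (cell w a b c y 14) :=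
  le_trans (polL₁_cell_nonneg w a b c y hL1)
    (polL₁_le_polL₂ (cell_nonneg w a b c y 0) (cell_nonneg w a b c y 1) (cell_nonneg w a b c y 2) (cell_nonneg w a b c y 3)
      (cell_nonneg w a b c y 4) (cell_nonneg w a b c y 5) (cell_nonneg w a b c y 6) (cell_nonneg w a b c y 7)
      (cell_nonneg w a b c y 8) (cell_nonneg w a b c y 9) (cell_nonneg w a b c y 10) (cell_nonneg w a b c y 11)
      (cell_nonneg w a b c y 12) (cell_nonneg w a b c y 13) (cell_nonneg w a b c y 14) (hybE₃g_cell_nonneg w a b c y))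

/-! ### SHK3⁺ and the Harris terms at cell level -/

set_option maxRecDepth 10000 in
set_option maxHeartbeats 1600000 in
/-- **`F(x⁰)` of the three-point marginal is SHK3⁺ = `E₃({a↮b},{a↮c},{b↮c})`** (cells; total mass one). [this work] -/
theorem F_cell_eq :
    F (cell w a b c y 0 + cell w a b c y 1 + cell w a b c y 2 + cell w a b c y 4) (cell w a b c y 6 + cell w a b c y 11 + cell w a b c y 12) (cell w a b c y 5 + cell w a b c y 9 + cell w a b c y 10) (cell w a b c y 3 + cell w a b c y 7 + cell w a b c y 8) (cell w a b c y 13 + cell w a b c y 14) =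
      sahiE3 (prodBernoulli w) (openConn a b)ᶜ (openConn a c)ᶜ (openConn b c)ᶜ := by
  rw [sahiE3_def, real_shk_ABC, real_hyb2_C, real_hyb1_B, real_hyb1_A, real_shk_BC, real_shk_AC, real_shk_AB]
  have h14 : cell w a b c y 14 = 1 - (cell w a b c y 0 + cell w a b c y 1 + cell w a b c y 2 + cell w a b c y 3 + cell w a b c y 4 + cell w a b c y 5 + cell w a b c y 6 + cell w a b c y 7 + cell w a b c y 8 + cell w a b c y 9 + cell w a b c y 10 + cell w a b c y 11 + cell w a b c y 12 + cell w a b c y 13) := by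
    have := sum_cell_eq_one w a b c y
    linarith
  simp only [F]
  rw [h14]
  ring

/-- **`F(x⁰) ≥ 0`** — prim-lit-2 / prim-cert-2's theorem SHK3⁺ = 3PT-LB (`ThreePointLB.sahiE3_pairSep_nonneg`). [this work] -/
theorem F_cell_nonneg :
    0 ≤ F (cell w a b c y 0 + cell w a b c y 1 + cell w a b c y 2 + cell w a b c y 4) (cell w a b c y 6 + cell w a b c y 11 + cell w a b c y 12) (cell w a b c y 5 + cell w a b c y 9 + cell w a b c y 10) (cell w a b c y 3 + cell w a b c y 7 + cell w a b c y 8) (cell w a b c y 13 + cell w a b c y 14) := by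
  rw [F_cell_eq]
  exact ThreePointLB.sahiE3_pairSep_nonneg w a b c

/-- Harris for `D_ab`, `D_ac` in cells: `m(D_ab)·m(D_ac) ≤ m(D_ab ∩ D_ac)`. [this work] -/
theorem harris_ab_ac_cell :
    (cell w a b c y 0 + cell w a b c y 1 + cell w a b c y 2 + cell w a b c y 3 + cell w a b c y 4 + cell w a b c y 5 + cell w a b c y 7 + cell w a b c y 8 + cell w a b c y 9 + cell w a b c y 10) * (cell w a b c y 0 + cell w a b c y 1 + cell w a b c y 2 + cell w a b c y 3 + cell w a b c y 4 + cell w a b c y 6 + cell w a b c y 7 + cell w a b c y 8 + cell w a b c y 11 + cell w a b c y 12) ≤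
      cell w a b c y 0 + cell w a b c y 1 + cell w a b c y 2 + cell w a b c y 3 + cell w a b c y 4 + cell w a b c y 7 + cell w a b c y 8 := by
  have h := prodBernoulli_harris_lower w (isLowerSet_compl_openConn a b) (isLowerSet_compl_openConn a c)
    MeasurableSet.of_discrete MeasurableSet.of_discrete
  rwa [real_hyb2_C, real_hyb1_B, real_shk_AB] at h

/-- Harris for `D_ac`, `D[ay|b]` in cells. [this work] -/
theorem harris_ac_Gab_cell :
    (cell w a b c y 0 + cell w a b c y 1 + cell w a b c y 2 + cell w a b c y 3 + cell w a b c y 4 + cell w a b c y 6 + cell w a b c y 7 + cell w a b c y 8 + cell w a b c y 11 + cell w a b c y 12) * (cell w a b c y 0 + cell w a b c y 1 + cell w a b c y 3 + cell w a b c y 4 + cell w a b c y 5 + cell w a b c y 8 + cell w a b c y 10) ≤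
      cell w a b c y 0 + cell w a b c y 1 + cell w a b c y 3 + cell w a b c y 4 + cell w a b c y 8 := by
  have h := prodBernoulli_harris_lower w (isLowerSet_compl_openConn a c)
    ((isLowerSet_compl_openConn b a).inter (isLowerSet_compl_openConn b y)) MeasurableSet.of_discrete MeasurableSet.of_discrete
  rwa [real_hyb1_B, real_hyb1_C, real_hyb1_BC] at h

/-- Harris for `D[ay|c]`, `D_ab` in cells. [this work] -/
theorem harris_Gac_ab_cell :
    (cell w a b c y 0 + cell w a b c y 2 + cell w a b c y 3 + cell w a b c y 4 + cell w a b c y 6 + cell w a b c y 8 + cell w a b c y 12) * (cell w a b c y 0 + cell w a b c y 1 + cell w a b c y 2 + cell w a b c y 3 + cell w a b c y 4 + cell w a b c y 5 + cell w a b c y 7 + cell w a b c y 8 + cell w a b c y 9 + cell w a b c y 10) ≤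
      cell w a b c y 0 + cell w a b c y 2 + cell w a b c y 3 + cell w a b c y 4 + cell w a b c y 8 := by
  have h := prodBernoulli_harris_lower w ((isLowerSet_compl_openConn c a).inter (isLowerSet_compl_openConn c y))
    (isLowerSet_compl_openConn a b) MeasurableSet.of_discrete MeasurableSet.of_discrete
  rwa [real_hyb2_B, real_hyb2_C, real_hyb2_BC] at h

/-! ### (L1) ⇒ (B1), (B2) at cell level -/

/-- **(L1) ⇒ (B1)**: the first Bernstein piece `threeB₁` at the cells of any finite weighted graph is nonnegative
(`threeB₁ = polL₁ + F + (β₁+β₂)·Harris`, prim-l12-p6 `threeB₁_eq_polL₁`). [this work] -/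
theorem threeB₁_cell_nonneg (hL1 : PolarisedRowL1) :
    0 ≤ threeB₁ (cell w a b c y 0 + cell w a b c y 1 + cell w a b c y 2 + cell w a b c y 4) (cell w a b c y 6 + cell w a b c y 11 + cell w a b c y 12) (cell w a b c y 5 + cell w a b c y 9 + cell w a b c y 10) (cell w a b c y 3 + cell w a b c y 7 + cell w a b c y 8) (cell w a b c y 13 + cell w a b c y 14)
      (cell w a b c y 2) (cell w a b c y 1) (cell w a b c y 11) (cell w a b c y 9) (cell w a b c y 7) := by
  rw [threeB₁_eq_polL₁]
  have h1 := polL₁_cell_nonneg w a b c y hL1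
  have h2 := F_cell_nonneg w a b c y
  have h3 := harris_ab_ac_cell w a b c y
  have hβ : 0 ≤ cell w a b c y 11 + cell w a b c y 9 := add_nonneg (cell_nonneg w a b c y 11) (cell_nonneg w a b c y 9)
  simp only [Hh]
  rw [sum_cell_eq_one w a b c y]
  nlinarith [mul_nonneg hβ (sub_nonneg.2 h3)]

/-- **(L1) ⇒ (B2)**: the second Bernstein piece `threeB₂` at the cells of any finite weighted graph is nonnegative
(`threeB₂ = polL₂ + (β₁+β₂)·(Harris + Harris)`, prim-l12-p6 `threeB₂_eq_polL₂`; (L2) from (L1) and the group row). [this work] -/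
theorem threeB₂_cell_nonneg (hL1 : PolarisedRowL1) :
    0 ≤ threeB₂ (cell w a b c y 0 + cell w a b c y 1 + cell w a b c y 2 + cell w a b c y 4) (cell w a b c y 6 + cell w a b c y 11 + cell w a b c y 12) (cell w a b c y 5 + cell w a b c y 9 + cell w a b c y 10) (cell w a b c y 3 + cell w a b c y 7 + cell w a b c y 8) (cell w a b c y 13 + cell w a b c y 14)
      (cell w a b c y 2) (cell w a b c y 1) (cell w a b c y 11) (cell w a b c y 9) (cell w a b c y 7) := by
  rw [threeB₂_eq_polL₂]
  have h1 := polL₂_cell_nonneg w a b c y hL1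
  have h3 := harris_ac_Gab_cell w a b c y
  have h4 := harris_Gac_ab_cell w a b c y
  have hβ : 0 ≤ cell w a b c y 11 + cell w a b c y 9 := add_nonneg (cell_nonneg w a b c y 11) (cell_nonneg w a b c y 9)
  simp only [Hh]
  rw [sum_cell_eq_one w a b c y]
  nlinarith [mul_nonneg hβ (sub_nonneg.2 h3), mul_nonneg hβ (sub_nonneg.2 h4)]

end Cells

/-! ### (L1) ⇒ (L2) at measure level -/

/-- **(L1) ⇒ (L2)** on every finite weighted graph: `PolarisedRowL1 → PolarisedRowL2`.  Since `L2 − L1 = E₃(D_bc, D[ay|c], D[ay|b]) +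
μ(a|bcy)·(μ(ab|cy) + μ(ac|by))` (prim-l12-p6 `polL₂_eq_polL₁_add`) and the group row is prim-ineq-prove-3's theorem GRP3PTLB. [this work] -/
theorem polarisedRowL2_of_polarisedRowL1 (hL1 : PolarisedRowL1) : PolarisedRowL2 := by
  intro V _ w a b c y
  have h := polL₂_cell_nonneg w a b c y hL1
  rw [polL₂_cell_eq] at h
  exact sub_nonneg.1 h

end TerminalEdgeStep

end Summit.CriticalPhenomena.PercolationContinuityZ3.Theorems
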